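import Mathlib
import Summits.QuantumFields.YangMills.Theses.TransverseWardBL

/-!
# TransverseWardBL — proof of the Assembly item

`Assembly : BoxSecondMoment → WardPinning → ConvexPhaseTransverseBound → LargeFieldInsensitivity → BoxHodgeSplit →
TorusMeanPlaqLower → U1HelicityGapTorusD4` of route `route-QuantumFields-TransverseWardBL` (D-0145 LINE, seat ym-idea-4 g9):
logic and real arithmetic only (β₁* = max of the thresholds and 1, δ = 1/10, ε = 1/20). No summit and no crux is proved here.
-/

namespace Summit.QuantumFields.YangMills.Theorems

open Summit.QuantumFields.YangMills.Theses.TransverseWardBL in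
/-- The Assembly item of route TransverseWardBL holds: the six items imply the torus helicity-gap node with `δ = 1/10`. [folklore] -/
theorem transverseWardBL_assembly : Summit.QuantumFields.YangMills.Theses.TransverseWardBL.Assembly := by
  intro h0 h1 h2a h2b h3 h4
  obtain ⟨b₁, hb₁⟩ := h2a
  obtain ⟨b₂, hb₂⟩ := h2b
  obtain ⟨b₃, hb₃⟩ := h4
  refine ⟨max (max b₁ b₂) (max b₃ 1), fun β hβ => ?_⟩
  have hβ1 : b₁ < β := lt_of_le_of_lt ((le_max_left _ _).trans (le_max_left _ _)) hβ
  have hβ2 : b₂ < β := lt_of_le_of_lt ((le_max_right _ _).trans (le_max_left _ _)) hβ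
  have hβ3 : b₃ < β := lt_of_le_of_lt ((le_max_left _ _).trans (le_max_right _ _)) hβ
  have hβpos : 0 < β :=
    lt_of_lt_of_le one_pos (le_of_lt (lt_of_le_of_lt ((le_max_right _ _).trans (le_max_right _ _)) hβ))
  refine ⟨1 / 10, by norm_num, ?_⟩
  obtain ⟨N₀, hN₀⟩ := h3 (1 / 20) (by norm_num)
  refine ⟨N₀, fun N hN => ?_⟩
  obtain ⟨M₀, hM₀⟩ := hN₀ N hN
  refine ⟨M₀, fun M hM => ?_⟩
  obtain ⟨α, u, hsplit, hcc, hA, hB⟩ := hM₀ M hM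
  have e0 := h0 β M N
  have hfun : (fun p : Literature.MathematicalPhysics.QuantumFieldTheory.Plaquette 4 (M + 1) => (if p.2.1 = ((0 : Fin 4), (1 : Fin 4)) then (((Literature.Probability.LatticeModels.box 4 N).filter (fun x => (fun i => ((x i : ℤ) : ZMod (M + 1))) = p.1)).card : ℝ) else 0)) = (fun p : Literature.MathematicalPhysics.QuantumFieldTheory.Plaquette 4 (M + 1) => Literature.MathematicalPhysics.QuantumFieldTheory.LatticeForm.res (Literature.MathematicalPhysics.QuantumFieldTheory.LatticeForm.td₁ α) p + u p) := funext hsplit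
  have e1 := h1 β hβpos M α u hcc
  rw [← hfun] at e1
  obtain ⟨hZ, h2a'⟩ := hb₁ β hβ1 M u hcc
  have h2b' := abs_le.mp (hb₂ β hβ2 M u hcc)
  have hc := hb₃ β hβ3 M
  have hT : β * ((fun (β : ℝ) (M : ℕ) (w : Literature.MathematicalPhysics.QuantumFieldTheory.Plaquette 4 (M + 1) → ℝ) => Literature.MathematicalPhysics.QuantumFieldTheory.wilsonExpectation (L := M + 1) Literature.MathematicalPhysics.QuantumLattice.u1Rep β (fun U : Literature.MathematicalPhysics.QuantumFieldTheory.GaugeConfig 4 (M + 1) Circle => (∑ p : Literature.MathematicalPhysics.QuantumFieldTheory.Plaquette 4 (M + 1), (w) p * ((Literature.MathematicalPhysics.QuantumFieldTheory.plaquetteHolonomy U p.1 p.2.1.1 p.2.1.2 : Circle) : ℂ).im) ^ 2)) β M u) * ((fun (β : ℝ) (M : ℕ) => Literature.MathematicalPhysics.QuantumFieldTheory.wilsonExpectation (L := M + 1) Literature.MathematicalPhysics.QuantumLattice.u1Rep β (fun U : Literature.MathematicalPhysics.QuantumFieldTheory.GaugeConfig 4 (M + 1) Circle => (if (∀ p :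 Literature.MathematicalPhysics.QuantumFieldTheory.Plaquette 4 (M + 1), Real.cos 1 ≤ ((Literature.MathematicalPhysics.QuantumFieldTheory.plaquetteHolonomy U p.1 p.2.1.1 p.2.1.2 : Circle) : ℂ).re) then (1 : ℝ) else 0))) β M) ≤ (1 / 2 : ℝ) * (∑ p : Literature.MathematicalPhysics.QuantumFieldTheory.Plaquette 4 (M + 1), ((u) p) ^ 2) * ((fun (β : ℝ) (M : ℕ) => Literature.MathematicalPhysics.QuantumFieldTheory.wilsonExpectation (L := M + 1) Literature.MathematicalPhysics.QuantumLattice.u1Rep β (fun U : Literature.MathematicalPhysics.QuantumFieldTheory.GaugeConfig 4 (M + 1) Circle => (if (∀ p : Literature.MathematicalPhysics.QuantumFieldTheory.Plaquette 4 (M + 1), Real.cos 1 ≤ ((Literature.MathematicalPhysics.QuantumFieldTheory.plaquetteHolonomy U p.1 p.2.1.1 p.2.1.2 : Circle) : ℂ).re) then (1 : ℝ) else 0))) β M) := by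
    linarith [h2b'.1, h2b'.2, h2a']
  have hT' : β * ((fun (β : ℝ) (M : ℕ) (w : Literature.MathematicalPhysics.QuantumFieldTheory.Plaquette 4 (M + 1) → ℝ) => Literature.MathematicalPhysics.QuantumFieldTheory.wilsonExpectation (L := M + 1) Literature.MathematicalPhysics.QuantumLattice.u1Rep β (fun U : Literature.MathematicalPhysics.QuantumFieldTheory.GaugeConfig 4 (M + 1) Circle => (∑ p : Literature.MathematicalPhysics.QuantumFieldTheory.Plaquette 4 (M + 1), (w) p * ((Literature.MathematicalPhysics.QuantumFieldTheory.plaquetteHolonomy U p.1 p.2.1.1 p.2.1.2 : Circle) : ℂ).im) ^ 2)) β M u) ≤ (1 / 2 : ℝ) * (∑ p : Literature.MathematicalPhysics.QuantumFieldTheory.Plaquette 4 (M + 1), ((u) p) ^ 2) := le_of_mul_le_mul_right hT hZ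
  have hn : (0 : ℝ) ≤ ((Literature.Probability.LatticeModels.box 4 N).card : ℝ) := by positivity
  have hc0 : (0 : ℝ) ≤ Summit.QuantumFields.YangMills.Theorems.U1Helicity.torusMeanPlaq β M := by linarith
  have hA' := mul_le_mul_of_nonneg_left hA hc0
  rw [e0]
  nlinarith [hA', hT', hB, mul_nonneg (sub_nonneg.mpr hc) hn, e1]

end Summit.QuantumFields.YangMills.Theorems
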